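import Mathlib
import Summits.ValiantsHypothesis.ValiantsHypothesis.Theorems.NewtonUnitEquationsTwoProductsPlanarCrossCount
import Summits.ValiantsHypothesis.ValiantsHypothesis.Theorems.NewtonUnitEquationsTwoProductsFormalLogLinearisationLogSumEngineOne
import Summits.ValiantsHypothesis.ValiantsHypothesis.Theorems.TwoProducts.Negative.PlanarSlotBoundFalse
import HarnessLib

/-!
# Crux `TwoProducts` (stmt-ValiantsHypothesis-5906), line `planar_cell`: SUB₁ `PlanarCross`, SUB₂ refuted by name, and the
# quasi-polynomial cell bound from SUB₁ alone (Theorems port, 2/2)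

Port of the PROVED, LIVE content of val-idea-8's line `Cruxes/TwoProducts/Lines/planar_cell.lean` (v2 @c79afd9dab00) into
`Theorems/` (val-lit-p3 g13; desk RULINGS #133/#145; `--supports stmt-ValiantsHypothesis-5906 --as helper`):

* `PlanarCross` (SUB₁, OPEN) and `PlanarSlotBound` (SUB₂) — the line's two typed sub-statements, VERBATIM;
* `not_planarSlotBound' : ¬ PlanarSlotBound` — SUB₂ refuted BY NAME, from the kernel negative
  `Theorems.TwoProducts.Negative.not_planarSlotBound` (p600147; the statement there is this `def` unfolded, so the proof
  is the term itself);
* `quasiPolyCell_of_planarCross` — **SUB₁ alone ⇒ the QUASI-POLYNOMIAL cell bound** `#S ≤ (L+1)·n^L·(2mt)^L`,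
  `n = (2m)^c`, `L = log₂ n` (verbatim; `planarCount_cell` with the trivial slot width `#tail support ≤ 2mt`);
* the all-`m` lemma `eq_of_visible_mem_tailSupport` (a cell family contains at most one tail exponent) and the `m = 1`
  bodies `logVisible_subset_tailSupport_one`, `planarCross_one` (verbatim).

Why this is what survives (NOTE §13, HOME/lmr; `Lines/planar_cell_dead.md`): per-cell visible counts are NOT `t`-free
(`≈ √(2t)` at `m = 2`), so the `t`-free recombination `planarCellBound_of` is unattainable and is not ported; the value of
the line is SUB₁, which alone yields a `t^{O(log m)}` vertex bound for `∏ f_j − ∏ g_j` through the landed sweep (p596451) —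
IF `PlanarCross` is proved.  Honest framing: `PlanarCross`, `PlanarCellBound`, the engine and the crux `TwoProducts` are
OPEN; nothing here is progress on `VP ≠ VNP` (NOT proved).  No named facts. [folklore]
-/

noncomputable section

-- Sub = Summit single-conjunct layout: the duplicated namespace component is mandated by the tree.
set_option linter.dupNamespace false

open scoped BigOperators
open MvPolynomial
open Summit.ValiantsHypothesis.ValiantsHypothesis.Theorems.NewtonUnitEquations.TwoProducts.FormalLogLinearisation

namespace Summit.ValiantsHypothesis.ValiantsHypothesis.Theorems.NewtonUnitEquations.TwoProducts.PlanarCell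

variable {m : ℕ}

/-! ## The two sub-statements of the line (verbatim) -/

/-- **SUB₁ — PLANAR CROSS** (the theory memo's question Q1, typed; planar stand-in for `ExpSum.hyperbolicCross`).
Every visible point `λ` of `supp D`, `D = Σ_j log(1+u_j) − Σ_j log(1+v_j)`, has a decomposition `λ = Σ_e μ_e·e` over the
tail support with `∏_e (μ_e + 1) ≤ (2m)^c` — polynomially many box points below it, uniformly in the sparsity `t` and in
the size of the tail support.  (`t`-free; for a point with a SINGLETON fibre this is the lifted hyperbolic-cross lemma
with `2m` terms; the content is at planar points whose fibre carries cancellation.) -/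
def PlanarCross : Prop :=
  ∃ c : ℕ, ∀ (m : ℕ) (u v : Fin m → MvPolynomial (Fin 2) ℂ),
    (∀ j, coeff 0 (u j) = 0) → (∀ j, coeff 0 (v j) = 0) →
    ∀ (s : ℕ) (E : Fin s → Expo), Function.Injective E → Set.range E = ↑(tailSupport u v) →
    ∀ l ∈ logVisible u v, ∃ μ : Fin s → ℕ, lam E μ = l ∧ ∏ i, (μ i + 1) ≤ (2 * m) ^ c

/-- **SUB₂ — PLANAR SLOT BOUND** (the fibre-sum RANK step of NOTE §12, typed as a `t`-FREE COUNT; planar stand-in for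
`ExpSum.slotRank_card_le`).  Fix tails, an injective enumeration `E` of the tail support, a relation `R` on coordinates
(a weight-order CELL) and an exponent `e ≥ 1`.  Let `D` be a set of coordinates such that every `d ∈ D` carries a
representative `rep d` in the cross `∏ (rep d_i + 1) ≤ (2m)^c` with `(rep d)_d = e`, whose planar image `Λ_E (rep d)`
is a visible point of `supp D` with a valid witness weight inducing `R`, the planar images being pairwise DISTINCT.
Then `#D ≤ (2m)^{c'}` — independently of `t` and of the size of the tail support.  (In the lifted/dissociated regime the
replacement matrix `(D(Λρ_y + e·E_{d_x}))_{x,y}` is triangular of Hankel rank `≤ 2m`, giving `#D ≤ 2m`; planar-side it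
is still triangular with nonzero diagonal — lighter planar points are vanishing FIBRE SUMS — but its entries are fibre
sums with multinomial weights and no rank bound is known: THIS is the open `m`-uniformity.) -/
def PlanarSlotBound : Prop :=
  ∀ c : ℕ, ∃ c' : ℕ, ∀ (m : ℕ) (u v : Fin m → MvPolynomial (Fin 2) ℂ),
    (∀ j, coeff 0 (u j) = 0) → (∀ j, coeff 0 (v j) = 0) →
    ∀ (s : ℕ) (E : Fin s → Expo), Function.Injective E → Set.range E = ↑(tailSupport u v) →
    ∀ (R : Fin s → Fin s → Prop) (e : ℕ), 1 ≤ e → ∀ (D : Finset (Fin s)) (rep : Fin s → (Fin s → ℕ)),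
      (∀ d ∈ D, rep d d = e ∧ ∏ i, (rep d i + 1) ≤ (2 * m) ^ c ∧
        ∃ ξ : Fin 2 → ℝ, ValidWeight u v ξ ∧ IsStrictTop ξ (logSupport u v) (lam E (rep d)) ∧
          ∀ j j' : Fin s, R j j' ↔ wt ξ (E j) ≤ wt ξ (E j')) →
      Set.InjOn (fun d => lam E (rep d)) ↑D → D.card ≤ (2 * m) ^ c'

/-- **SUB₂ is FALSE, by name.**  `Theorems.TwoProducts.Negative.not_planarSlotBound` (p600147) refutes exactly this
statement (there unfolded: `lam E μ = Σ_i μ_i • E_i`, `tailSupport` = the union of the tail supports), by the `m = 2`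
staircase family of `…/Negative/PlanarSlotBoundFalseFamily.lean` (p599847): one weight-order cell with `K + 1` visible
corners for every `K`. [folklore] -/
theorem not_planarSlotBound' : ¬ PlanarSlotBound :=
  Summit.ValiantsHypothesis.ValiantsHypothesis.Theorems.TwoProducts.Negative.not_planarSlotBound

/-! ## What SUB₁ alone gives: a quasi-polynomial cell bound (verbatim) -/

/-- **SUB₁ alone ⇒ a QUASI-POLYNOMIAL cell bound** `#S ≤ (L+1)·n^L·(2mt)^L`, `n = (2m)^c`, `L = log₂ n` (the trivial
slot bound `#D ≤ #tail support ≤ 2mt` in `planarCount_cell`): the planar cross already replaces the exponent `m` of the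
trivial count `#supp(∏(1+u) − ∏(1+v)) ≤ 2(t+1)^m` by `O(c² log² m)`; SUB₂ is exactly what removes the last `t^{log m}`.
-/
theorem quasiPolyCell_of_planarCross (h₁ : PlanarCross) :
    ∃ c : ℕ, ∀ (m t : ℕ) (u v : Fin m → MvPolynomial (Fin 2) ℂ),
      (∀ j, coeff 0 (u j) = 0 ∧ (u j).support.card ≤ t) → (∀ j, coeff 0 (v j) = 0 ∧ (v j).support.card ≤ t) →
      ∀ (R : Expo → Expo → Prop) (S : Finset Expo),
        (∀ l ∈ S, ∃ ξ : Fin 2 → ℝ, ValidWeight u v ξ ∧ IsStrictTop ξ (logSupport u v) l ∧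
          ∀ e ∈ tailSupport u v, ∀ e' ∈ tailSupport u v, (R e e' ↔ wt ξ e ≤ wt ξ e')) →
        S.card ≤ (Nat.log 2 ((2 * m) ^ c) + 1) * ((2 * m) ^ c) ^ Nat.log 2 ((2 * m) ^ c) *
          (2 * m * t) ^ Nat.log 2 ((2 * m) ^ c) := by
  classical
  obtain ⟨c, h₁⟩ := h₁
  refine ⟨c, fun m t u v hu hv R S hS => ?_⟩
  rcases Nat.eq_zero_or_pos m with hm0 | hmpos
  · subst hm0
    have hS0 : S = ∅ := Finset.eq_empty_of_forall_notMem fun l hl => by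
      obtain ⟨ξ, -, htop, -⟩ := hS l hl
      exact htop.1 (by simp [logDiff])
    simp [hS0]
  set E₀ : Finset Expo := tailSupport u v with hE₀
  -- the tail support has at most `2mt` points
  have hEcard : E₀.card ≤ 2 * m * t := by
    calc E₀.card ≤ (Finset.univ.biUnion fun j => (u j).support).card +
          (Finset.univ.biUnion fun j => (v j).support).card := Finset.card_union_le _ _
      _ ≤ (∑ j : Fin m, ((u j).support).card) + ∑ j : Fin m, ((v j).support).card :=
          Nat.add_le_add Finset.card_biUnion_le Finset.card_biUnion_le
      _ ≤ (∑ _j : Fin m, t) + ∑ _j : Fin m, t :=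
          Nat.add_le_add (Finset.sum_le_sum fun j _ => (hu j).2) (Finset.sum_le_sum fun j _ => (hv j).2)
      _ = 2 * m * t := by simp; ring
  set s := E₀.card with hs
  set σ := E₀.equivFin with hσ
  let E : Fin s → Expo := fun i => ((σ.symm i : ↥E₀) : Expo)
  have hEinj : Function.Injective E := fun i i' h => σ.symm.injective (Subtype.ext h)
  have hEmem : ∀ i, E i ∈ E₀ := fun i => (σ.symm i).2
  have hErange : Set.range E = ↑E₀ := by
    ext x
    constructor
    · rintro ⟨i, rfl⟩
      exact hEmem i
    · intro hx
      refine ⟨σ ⟨x, hx⟩, ?_⟩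
      simp [E]
  have hrep : ∀ l ∈ S, ∃ μ : Fin s → ℕ, lam E μ = l ∧ ∏ i, (μ i + 1) ≤ (2 * m) ^ c := by
    intro l hl
    obtain ⟨ξ, hval, htop, -⟩ := hS l hl
    exact h₁ m u v (fun j => (hu j).1) (fun j => (hv j).1) s E hEinj hErange l ⟨ξ, hval, htop⟩
  choose! rep₀ hrep₀ hcross₀ using hrep
  set C : Finset (Fin s → ℕ) := S.image rep₀ with hC
  have hCcard : C.card = S.card :=
    Finset.card_image_of_injOn fun l hl l' hl' h => by
      have := congrArg (lam E) h
      rwa [hrep₀ l hl, hrep₀ l' hl'] at this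
  have hCmem : ∀ μ ∈ C, ∃ l ∈ S, rep₀ l = μ := fun μ hμ => by
    simpa only [hC, Finset.mem_image] using hμ
  let R' : Fin s → Fin s → Prop := fun j j' => R (E j) (E j')
  -- empty tail support: no visible points at all (a visible point has a representative, `Fin 0 → ℕ` gives `0 ∉ supp D`)
  rcases Nat.eq_zero_or_pos s with hs0 | hspos
  · have hS0 : S = ∅ := Finset.eq_empty_of_forall_notMem fun l hl => by
      obtain ⟨ξ, hval, htop, -⟩ := hS l hl
      have hl0 : l = 0 := by
        rw [← hrep₀ l hl]
        unfold lam
        have hemp : IsEmpty (Fin s) := by rw [hs0]; infer_instance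
        have : (Finset.univ : Finset (Fin s)) = ∅ := Finset.univ_eq_empty_iff.2 hemp
        rw [this, Finset.sum_empty]
      apply htop.1
      rw [hl0]
      simp [logDiff, logCoeff]
    simp [hS0]
  have key := planarCount_cell E hEinj (logSupport u v) R' ((2 * m) ^ c) s hspos C
    (fun μ hμ => by
      obtain ⟨l, hl, rfl⟩ := hCmem μ hμ
      obtain ⟨ξ, -, htop, hRξ⟩ := hS l hl
      exact ⟨hcross₀ l hl, ξ, by rw [hrep₀ l hl]; exact htop, fun j j' => hRξ (E j) (hEmem j) (E j') (hEmem j')⟩)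
    (fun e _ D _ _ _ => by
      calc D.card ≤ (Finset.univ : Finset (Fin s)).card := Finset.card_le_card (Finset.subset_univ D)
        _ = s := by simp)
  rw [← hCcard]
  refine key.trans ?_
  gcongr

/-! ## Calibration: at most one tail exponent per cell (all `m`); the `m = 1` body of SUB₁ (verbatim) -/

/-- **At most ONE visible point of a cell family lies in the tail support** (all `m`): two distinct tail exponents
that are both in `supp D` are `R`-comparable, and the `R`-heavier one refutes the strict top of the other. -/
theorem eq_of_visible_mem_tailSupport (u v : Fin m → MvPolynomial (Fin 2) ℂ) (R : Expo → Expo → Prop)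
    {l l' : Expo} (hl : l ∈ tailSupport u v) (hl' : l' ∈ tailSupport u v) {ξ ξ' : Fin 2 → ℝ}
    (htop : IsStrictTop ξ (logSupport u v) l) (htop' : IsStrictTop ξ' (logSupport u v) l')
    (hR : ∀ e ∈ tailSupport u v, ∀ e' ∈ tailSupport u v, (R e e' ↔ wt ξ e ≤ wt ξ e'))
    (hR' : ∀ e ∈ tailSupport u v, ∀ e' ∈ tailSupport u v, (R e e' ↔ wt ξ' e ≤ wt ξ' e')) : l = l' := by
  by_contra hne
  rcases le_total (wt ξ' l') (wt ξ' l) with hle | hle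
  · have := htop'.2 l htop.1 hne
    linarith
  · have hle2 : wt ξ l ≤ wt ξ l' := (hR l hl l' hl').1 ((hR' l hl l' hl').2 hle)
    have := htop.2 l' htop'.1 (Ne.symm hne)
    linarith

/-- For `m = 1` every visible point of `supp D` is a tail exponent (`…LogSumEngineOne.logVisible_subset_support_sub`:
it is a monomial of `u − v`). -/
theorem logVisible_subset_tailSupport_one (u v : Fin 1 → MvPolynomial (Fin 2) ℂ)
    (hu0 : ∀ j, coeff 0 (u j) = 0) (hv0 : ∀ j, coeff 0 (v j) = 0) :
    logVisible u v ⊆ ↑(tailSupport u v) := by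
  classical
  intro l hl
  have h := logVisible_subset_support_sub u v (hu0 0) (hv0 0) hl
  have h2 := MvPolynomial.support_sub _ (u 0) (v 0) h
  simp only [Finset.mem_union] at h2
  simp only [tailSupport, Finset.coe_union, Set.mem_union, Finset.mem_coe, Finset.mem_biUnion, Finset.mem_univ,
    true_and]
  rcases h2 with h2 | h2
  · exact Or.inl ⟨0, h2⟩
  · exact Or.inr ⟨0, h2⟩

/-- **RUNG: SUB₁ at `m = 1`** (with `c = 1`): a visible point is a tail exponent `E_i = Λ_E(e_i)`, and
`∏ ((e_i)_j + 1) = 2 ≤ 2·1`. -/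
theorem planarCross_one (u v : Fin 1 → MvPolynomial (Fin 2) ℂ)
    (hu0 : ∀ j, coeff 0 (u j) = 0) (hv0 : ∀ j, coeff 0 (v j) = 0)
    (s : ℕ) (E : Fin s → Expo) (_hE : Function.Injective E) (hrange : Set.range E = ↑(tailSupport u v)) :
    ∀ l ∈ logVisible u v, ∃ μ : Fin s → ℕ, lam E μ = l ∧ ∏ i, (μ i + 1) ≤ (2 * 1) ^ 1 := by
  classical
  intro l hl
  have hlE : l ∈ Set.range E := by rw [hrange]; exact logVisible_subset_tailSupport_one u v hu0 hv0 hl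
  obtain ⟨i, rfl⟩ := hlE
  refine ⟨Pi.single i 1, lam_single E i, ?_⟩
  rw [Finset.prod_eq_single i (fun j _ hj => by simp [hj]) (fun h => absurd (Finset.mem_univ i) h)]
  simp

end Summit.ValiantsHypothesis.ValiantsHypothesis.Theorems.NewtonUnitEquations.TwoProducts.PlanarCell

end
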